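import Mathlib
import Summits.SmoothPoincare4.SmoothPoincare4.Theorems.HyperbolicEnd.Negative.PsiContDiff

/-!
# `HyperbolicEnd` (stmt-SmoothPoincare4-7825), line `Sketch`, negative side — the slice Hessian of `ψ_M`

Helper for the native frozen refutation of `stub_certificateFill` on `ℝ⁴ = EuclideanSpace ℝ (Fin 4)`
(stub helper_frozen_psiSlice, registered on the crux item).

**The computation.** With `q₁ x = x 0 ^ 2 + x 1 ^ 2`, `q₂ x = x 2 ^ 2 + x 3 ^ 2`, `ε = 1/1000`, the
cutoff `χ t = Real.smoothTransition ((81/100 - t) * (25/14))` and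
`ψ_M x = -8 χ (q₂ x) log (q₁ x + ε) + M q₂ x + (q₁ x + q₂ x)`, the second derivative
`D²ψ_M(x)[v, v] = iteratedFDeriv ℝ 2 ψ_M x ![v, v]` is the second derivative at `t = 0` of the
slice `t ↦ ψ_M (x + t • v)` (`iteratedFDeriv_two_of_line`, the line lemma of
`Negative/NeckDensity.lean` transported from `ℂ` to a real normed space).  Along the line,
`qⱼ (x + t • v) = qⱼ + 2 βⱼ t + γⱼ t²` with `β₁ = x 0 v 0 + x 1 v 1`, `γ₁ = v 0 ² + v 1 ²` (and
similarly `β₂`, `γ₂`), so the slice is the explicit one-variable function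
`e t = -8 A t · B t + M Q₂ t + (Q₁ t + Q₂ t)`, `A = χ ∘ Q₂`, `B = log ∘ (Q₁ + ε)`, whose first two
derivatives are computed with the one-variable `HasDerivAt` calculus (`slice_hasDerivAt`,
`slice_deriv_hasDerivAt`): `A'(0) = χ'(q₂) 2β₂`, `A''(0) = χ''(q₂) (2β₂)² + χ'(q₂) 2γ₂`,
`B'(0) = 2β₁/(q₁ + ε)`, `B''(0) = (2γ₁ (q₁ + ε) - (2β₁)²)/(q₁ + ε)²`, `(AB)'' = A''B + 2A'B' + AB''`,
`Qⱼ'' = 2γⱼ`; here `χ' = deriv χ`, `χ'' = deriv (deriv χ)` (`χ` is smooth).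
-/

noncomputable section

-- the prescribed namespace `Summit.<P>.<Sub>.…` duplicates `SmoothPoincare4` (P = Sub)
set_option linter.dupNamespace false

open scoped ContDiff Topology Real
open Laplacian Set Filter Metric Complex

namespace Summit.SmoothPoincare4.SmoothPoincare4.Theorems.HyperbolicEnd.Negative

/-! ### One-variable reduction: second derivatives along lines -/

/-- **Line lemma.** For a real function `f` on a real normed space, `C²` at `x`, the second
directional derivative `D²f(x)[v, v]` is the second derivative at `0` of the slice
`t ↦ f (x + t • v)`, read off from one-variable `HasDerivAt` data
(the line lemma of `Negative/NeckDensity.lean`, with `ℂ` replaced by a normed space). -/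
private theorem iteratedFDeriv_two_of_line {E : Type*} [NormedAddCommGroup E] [NormedSpace ℝ E]
    {f : E → ℝ} {x v : E} (hf : ContDiffAt ℝ 2 f x) {m₁ : ℝ → ℝ} {m₂ : ℝ}
    (h₁ : ∀ᶠ t in 𝓝 (0 : ℝ), HasDerivAt (fun s : ℝ => f (x + s • v)) (m₁ t) t)
    (h₂ : HasDerivAt m₁ m₂ 0) :
    iteratedFDeriv ℝ 2 f x ![v, v] = m₂ := by
  -- the line through `x` in direction `v`
  set γ : ℝ → E := fun t => x + t • v with hγ_def
  have hγ : ∀ t, HasDerivAt γ v t := fun t => by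
    have h := ((hasDerivAt_id (t : ℝ)).smul_const v).const_add x
    simpa [hγ_def] using h
  have hγ0 : γ 0 = x := by simp [hγ_def]
  -- `f` is differentiable near `x`, `Df` is differentiable at `x`
  have hev : ∀ᶠ y in 𝓝 x, DifferentiableAt ℝ f y := by
    filter_upwards [hf.eventually (by simp)] with y hy
    exact hy.differentiableAt (by simp)
  have hD : DifferentiableAt ℝ (fderiv ℝ f) x :=
    (hf.fderiv_right (m := 1) (by norm_num)).differentiableAt one_ne_zero
  -- the slice and its first derivative near `0`
  have hφ' : ∀ᶠ t in 𝓝 (0 : ℝ),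
      HasDerivAt (fun s : ℝ => f (x + s • v)) (fderiv ℝ f (γ t) v) t := by
    have : ∀ᶠ t in 𝓝 (0 : ℝ), DifferentiableAt ℝ f (γ t) := by
      have hcont : ContinuousAt γ 0 := (hγ 0).continuousAt
      rw [← hγ0] at hev
      exact hcont.eventually hev
    filter_upwards [this] with t ht
    exact ht.hasFDerivAt.comp_hasDerivAt t (hγ t)
  -- so `m₁` agrees with `t ↦ Df(γ t) v` near `0`
  have hm₁ : m₁ =ᶠ[𝓝 0] fun t => fderiv ℝ f (γ t) v := by
    filter_upwards [h₁, hφ'] with t ht ht'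
    exact ht.unique ht'
  -- second derivative of the slice at `0`
  have h1 : HasDerivAt (fderiv ℝ f ∘ γ) (fderiv ℝ (fderiv ℝ f) (γ 0) v) 0 := by
    have hD' : DifferentiableAt ℝ (fderiv ℝ f) (γ 0) := by rw [hγ0]; exact hD
    exact hD'.hasFDerivAt.comp_hasDerivAt 0 (hγ 0)
  rw [hγ0] at h1
  have h2 := h1.clm_apply (hasDerivAt_const (0 : ℝ) v)
  simp only [ContinuousLinearMap.map_zero, add_zero, Function.comp_apply] at h2
  -- `h2 : HasDerivAt (fun t => fderiv ℝ f (γ t) v) (fderiv ℝ (fderiv ℝ f) x v v) 0`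
  have h3 : HasDerivAt m₁ (fderiv ℝ (fderiv ℝ f) x v v) 0 := h2.congr_of_eventuallyEq hm₁
  rw [iteratedFDeriv_two_apply]
  simpa using (h₂.unique h3).symm

/-! ### The cutoff profile `χ t = smoothTransition ((81/100 - t) (25/14))` -/

/-- `χ` is smooth. -/
private theorem chi_contDiff :
    ContDiff ℝ ∞ (fun t : ℝ => Real.smoothTransition ((81 / 100 - t) * (25 / 14))) :=
  Real.smoothTransition.contDiff.comp ((contDiff_const.sub contDiff_id).mul contDiff_const)

/-- `χ` has derivative `χ' = deriv χ` everywhere. -/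
private theorem chi_hasDerivAt (t : ℝ) :
    HasDerivAt (fun t : ℝ => Real.smoothTransition ((81 / 100 - t) * (25 / 14)))
      (deriv (fun t : ℝ => Real.smoothTransition ((81 / 100 - t) * (25 / 14))) t) t :=
  ((contDiff_infty_iff_deriv.mp chi_contDiff).1 t).hasDerivAt

/-- `χ'` has derivative `χ'' = deriv (deriv χ)` everywhere. -/
private theorem chi_deriv_hasDerivAt (t : ℝ) :
    HasDerivAt (deriv (fun t : ℝ => Real.smoothTransition ((81 / 100 - t) * (25 / 14))))
      (deriv (deriv (fun t : ℝ => Real.smoothTransition ((81 / 100 - t) * (25 / 14)))) t) t :=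
  ((contDiff_infty_iff_deriv.mp (contDiff_infty_iff_deriv.mp chi_contDiff).2).1 t).hasDerivAt

/-! ### The slice of `ψ_M` along a line -/

/-- Derivative of the quadratic `s ↦ A + 2Bs + Ns²`. -/
private theorem hasDerivAt_quad (A B N t : ℝ) :
    HasDerivAt (fun s : ℝ => A + 2 * B * s + N * s ^ 2) (2 * B + N * (2 * t)) t := by
  have h1 : HasDerivAt (fun s : ℝ => 2 * B * s) (2 * B) t := by
    simpa using (hasDerivAt_id' t).const_mul (2 * B)
  have h2 : HasDerivAt (fun s : ℝ => N * s ^ 2) (N * (2 * t)) t := by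
    simpa using (hasDerivAt_pow 2 t).const_mul N
  exact (h1.const_add A).fun_add h2

/-- Derivative of the linear function `s ↦ 2B + N(2s)` (the derivative of the quadratic). -/
private theorem hasDerivAt_quad' (B N t : ℝ) :
    HasDerivAt (fun s : ℝ => 2 * B + N * (2 * s)) (2 * N) t := by
  have h : HasDerivAt (fun s : ℝ => N * (2 * s)) (N * (2 * 1)) t :=
    ((hasDerivAt_id' t).const_mul 2).const_mul N
  simpa [mul_comm N 2] using h.const_add (2 * B)

/-- **First derivative of the slice.** With `Qⱼ s = qⱼ + 2βⱼ s + γⱼ s²`, the slice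
`e s = -8 χ(Q₂ s) log(Q₁ s + ε) + M Q₂ s + (Q₁ s + Q₂ s)` has derivative
`-8 (χ'(Q₂ s) Q₂' s · log(Q₁ s + ε) + χ(Q₂ s) · Q₁' s/(Q₁ s + ε)) + M Q₂' s + (Q₁' s + Q₂' s)`
wherever `Q₁ s + ε ≠ 0`. -/
private theorem slice_hasDerivAt (M q₁ β₁ γ₁ q₂ β₂ γ₂ s : ℝ)
    (h : q₁ + 2 * β₁ * s + γ₁ * s ^ 2 + 1 / 1000 ≠ 0) :
    HasDerivAt (fun s : ℝ =>
        -8 * Real.smoothTransition ((81 / 100 - (q₂ + 2 * β₂ * s + γ₂ * s ^ 2)) * (25 / 14)) *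
            Real.log (q₁ + 2 * β₁ * s + γ₁ * s ^ 2 + 1 / 1000) +
          M * (q₂ + 2 * β₂ * s + γ₂ * s ^ 2) +
          ((q₁ + 2 * β₁ * s + γ₁ * s ^ 2) + (q₂ + 2 * β₂ * s + γ₂ * s ^ 2)))
      (-8 * (deriv (fun t : ℝ => Real.smoothTransition ((81 / 100 - t) * (25 / 14)))
                (q₂ + 2 * β₂ * s + γ₂ * s ^ 2) * (2 * β₂ + γ₂ * (2 * s)) *
              Real.log (q₁ + 2 * β₁ * s + γ₁ * s ^ 2 + 1 / 1000) +
            Real.smoothTransition ((81 / 100 - (q₂ + 2 * β₂ * s + γ₂ * s ^ 2)) * (25 / 14)) *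
              ((2 * β₁ + γ₁ * (2 * s)) / (q₁ + 2 * β₁ * s + γ₁ * s ^ 2 + 1 / 1000))) +
        M * (2 * β₂ + γ₂ * (2 * s)) + ((2 * β₁ + γ₁ * (2 * s)) + (2 * β₂ + γ₂ * (2 * s)))) s := by
  have hQ₁ := hasDerivAt_quad q₁ β₁ γ₁ s
  have hQ₂ := hasDerivAt_quad q₂ β₂ γ₂ s
  have hA : HasDerivAt
      (fun s : ℝ => Real.smoothTransition ((81 / 100 - (q₂ + 2 * β₂ * s + γ₂ * s ^ 2)) * (25 / 14)))
      (deriv (fun t : ℝ => Real.smoothTransition ((81 / 100 - t) * (25 / 14)))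
          (q₂ + 2 * β₂ * s + γ₂ * s ^ 2) * (2 * β₂ + γ₂ * (2 * s))) s :=
    (chi_hasDerivAt _).comp s hQ₂
  have hB : HasDerivAt (fun s : ℝ => Real.log (q₁ + 2 * β₁ * s + γ₁ * s ^ 2 + 1 / 1000))
      ((2 * β₁ + γ₁ * (2 * s)) / (q₁ + 2 * β₁ * s + γ₁ * s ^ 2 + 1 / 1000)) s :=
    (hQ₁.add_const (1 / 1000)).log h
  refine ((((hA.const_mul (-8)).fun_mul hB).fun_add (hQ₂.const_mul M)).fun_add
    (hQ₁.fun_add hQ₂)).congr_deriv ?_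
  ring

/-- **Second derivative of the slice at `0`.** The derivative at `s = 0` of the first derivative
of the slice (as a function of `s`), for `q₁ + ε ≠ 0`, in the registered normal form. -/
private theorem slice_deriv_hasDerivAt (M q₁ β₁ γ₁ q₂ β₂ γ₂ : ℝ) (hq : q₁ + 1 / 1000 ≠ 0) :
    HasDerivAt (fun s : ℝ =>
      -8 * (deriv (fun t : ℝ => Real.smoothTransition ((81 / 100 - t) * (25 / 14)))
                (q₂ + 2 * β₂ * s + γ₂ * s ^ 2) * (2 * β₂ + γ₂ * (2 * s)) *
              Real.log (q₁ + 2 * β₁ * s + γ₁ * s ^ 2 + 1 / 1000) +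
            Real.smoothTransition ((81 / 100 - (q₂ + 2 * β₂ * s + γ₂ * s ^ 2)) * (25 / 14)) *
              ((2 * β₁ + γ₁ * (2 * s)) / (q₁ + 2 * β₁ * s + γ₁ * s ^ 2 + 1 / 1000))) +
        M * (2 * β₂ + γ₂ * (2 * s)) + ((2 * β₁ + γ₁ * (2 * s)) + (2 * β₂ + γ₂ * (2 * s))))
      (-8 * (deriv (deriv (fun t : ℝ => Real.smoothTransition ((81 / 100 - t) * (25 / 14)))) q₂ *
              (2 * β₂) ^ 2 * Real.log (q₁ + 1 / 1000) +
            deriv (fun t : ℝ => Real.smoothTransition ((81 / 100 - t) * (25 / 14))) q₂ *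
              (2 * γ₂) * Real.log (q₁ + 1 / 1000) +
            2 * (deriv (fun t : ℝ => Real.smoothTransition ((81 / 100 - t) * (25 / 14))) q₂ *
              (2 * β₂)) * (2 * β₁ / (q₁ + 1 / 1000)) +
            Real.smoothTransition ((81 / 100 - q₂) * (25 / 14)) *
              ((2 * γ₁ * (q₁ + 1 / 1000) - (2 * β₁) ^ 2) / (q₁ + 1 / 1000) ^ 2)) +
        M * (2 * γ₂) + (2 * γ₁ + 2 * γ₂)) 0 := by
  have hQ₁ := hasDerivAt_quad q₁ β₁ γ₁ 0
  have hQ₂ := hasDerivAt_quad q₂ β₂ γ₂ 0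
  have hQ₁' := hasDerivAt_quad' β₁ γ₁ 0
  have hQ₂' := hasDerivAt_quad' β₂ γ₂ 0
  have h0 : q₁ + 2 * β₁ * 0 + γ₁ * (0 : ℝ) ^ 2 + 1 / 1000 ≠ 0 := by simpa using hq
  -- `A = χ ∘ Q₂`, `A' = (χ' ∘ Q₂) · Q₂'`, `B = log ∘ (Q₁ + ε)`, `B' = Q₁'/(Q₁ + ε)`
  have hA : HasDerivAt
      (fun s : ℝ => Real.smoothTransition ((81 / 100 - (q₂ + 2 * β₂ * s + γ₂ * s ^ 2)) * (25 / 14)))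
      (deriv (fun t : ℝ => Real.smoothTransition ((81 / 100 - t) * (25 / 14)))
          (q₂ + 2 * β₂ * 0 + γ₂ * 0 ^ 2) * (2 * β₂ + γ₂ * (2 * 0))) 0 :=
    (chi_hasDerivAt _).comp 0 hQ₂
  have hdA : HasDerivAt
      (fun s : ℝ => deriv (fun t : ℝ => Real.smoothTransition ((81 / 100 - t) * (25 / 14)))
        (q₂ + 2 * β₂ * s + γ₂ * s ^ 2))
      (deriv (deriv (fun t : ℝ => Real.smoothTransition ((81 / 100 - t) * (25 / 14))))
          (q₂ + 2 * β₂ * 0 + γ₂ * 0 ^ 2) * (2 * β₂ + γ₂ * (2 * 0))) 0 :=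
    (chi_deriv_hasDerivAt _).comp 0 hQ₂
  have hB : HasDerivAt (fun s : ℝ => Real.log (q₁ + 2 * β₁ * s + γ₁ * s ^ 2 + 1 / 1000))
      ((2 * β₁ + γ₁ * (2 * 0)) / (q₁ + 2 * β₁ * 0 + γ₁ * 0 ^ 2 + 1 / 1000)) 0 :=
    (hQ₁.add_const (1 / 1000)).log h0
  have hB' := hQ₁'.fun_div (hQ₁.add_const (1 / 1000)) h0
  refine ((((((hdA.fun_mul hQ₂').fun_mul hB).fun_add (hA.fun_mul hB')).const_mul (-8)).fun_add
    (hQ₂'.const_mul M)).fun_add (hQ₁'.fun_add hQ₂')).congr_deriv ?_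
  simp only [mul_zero, add_zero, ne_eq, OfNat.ofNat_ne_zero, not_false_eq_true, zero_pow]
  -- clear the denominators `a = q₁ + ε ≠ 0`
  generalize ha : q₁ + 1 / 1000 = a at hq ⊢
  field_simp
  ring

/-! ### The helper -/

/-- helper (T5b): the second directional derivative `D²ψ_M(x)[v, v]` of the potential
`ψ_M x = -8 χ(q₂ x) log(q₁ x + 10⁻³) + M q₂ x + (q₁ x + q₂ x)` in closed form
(`βⱼ`, `γⱼ` as in the module docstring). -/
theorem helper_frozen_psiSlice : ∀ (M : ℝ) (x v : EuclideanSpace ℝ (Fin 4)), iteratedFDeriv ℝ 2 (fun y : EuclideanSpace ℝ (Fin 4) => -8 * Real.smoothTransition ((81 / 100 - (y 2 ^ 2 + y 3 ^ 2)) * (25 / 14)) * Real.log (y 0 ^ 2 + y 1 ^ 2 + 1 / 1000) + M * (y 2 ^ 2 + y 3 ^ 2) + (y 0 ^ 2 + y 1 ^ 2 + y 2 ^ 2 + y 3 ^ 2)) x ![v, v] = -8 * (deriv (deriv (fun t : ℝ => Real.smoothTransition ((81 / 100 - t) * (25 / 14)))) (x 2 ^ 2 + x 3 ^ 2) * (2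 * (x 2 * v 2 + x 3 * v 3)) ^ 2 * Real.log (x 0 ^ 2 + x 1 ^ 2 + 1 / 1000) + deriv (fun t : ℝ => Real.smoothTransition ((81 / 100 - t) * (25 / 14))) (x 2 ^ 2 + x 3 ^ 2) * (2 * (v 2 ^ 2 + v 3 ^ 2)) * Real.log (x 0 ^ 2 + x 1 ^ 2 + 1 / 1000) + 2 * (deriv (fun t : ℝ => Real.smoothTransition ((81 / 100 - t) * (25 / 14))) (x 2 ^ 2 + x 3 ^ 2) * (2 * (x 2 * v 2 + x 3 * v 3))) * (2 * (x 0 * v 0 + x 1 * v 1) / (x 0 ^ 2 + x 1 ^ 2 + 1 / 1000)) + Real.smoothTransition ((81 / 100 - (x 2 ^ 2 + x 3 ^ 2)) * (25 / 14)) * ((2 * (v 0 ^ 2 + v 1 ^ 2) * (x 0 ^ 2 + x 1 ^ 2 + 1 / 1000) - (2 * (x 0 * v 0 + x 1 * v 1)) ^ 2) / (x 0 ^ 2 + x 1 ^ 2 + 1 / 1000) ^ 2)) + M * (2 * (v 2 ^ 2 + v 3 ^ 2)) + (2 * (v 0 ^ 2 + v 1 ^ 2) + 2 * (v 2 ^ 2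 + v 3 ^ 2)) := by
  intro M x v
  -- shorthand for the data of the two quadratics along the line
  set q₁ : ℝ := x 0 ^ 2 + x 1 ^ 2 with hq₁
  set q₂ : ℝ := x 2 ^ 2 + x 3 ^ 2 with hq₂
  set β₁ : ℝ := x 0 * v 0 + x 1 * v 1 with hβ₁
  set β₂ : ℝ := x 2 * v 2 + x 3 * v 3 with hβ₂
  set γ₁ : ℝ := v 0 ^ 2 + v 1 ^ 2 with hγ₁
  set γ₂ : ℝ := v 2 ^ 2 + v 3 ^ 2 with hγ₂
  have hq : q₁ + 1 / 1000 ≠ 0 := by positivity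
  -- the slice is the explicit one-variable function
  have hfun : ∀ s : ℝ, (fun y : EuclideanSpace ℝ (Fin 4) => -8 * Real.smoothTransition ((81 / 100 - (y 2 ^ 2 + y 3 ^ 2)) * (25 / 14)) * Real.log (y 0 ^ 2 + y 1 ^ 2 + 1 / 1000) + M * (y 2 ^ 2 + y 3 ^ 2) + (y 0 ^ 2 + y 1 ^ 2 + y 2 ^ 2 + y 3 ^ 2)) (x + s • v) =
        -8 * Real.smoothTransition ((81 / 100 - (q₂ + 2 * β₂ * s + γ₂ * s ^ 2)) * (25 / 14)) *
            Real.log (q₁ + 2 * β₁ * s + γ₁ * s ^ 2 + 1 / 1000) +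
          M * (q₂ + 2 * β₂ * s + γ₂ * s ^ 2) +
          ((q₁ + 2 * β₁ * s + γ₁ * s ^ 2) + (q₂ + 2 * β₂ * s + γ₂ * s ^ 2)) := by
    intro s
    have e1 : (x 0 + s * v 0) ^ 2 + (x 1 + s * v 1) ^ 2 = q₁ + 2 * β₁ * s + γ₁ * s ^ 2 := by
      rw [hq₁, hβ₁, hγ₁]; ring
    have e2 : (x 2 + s * v 2) ^ 2 + (x 3 + s * v 3) ^ 2 = q₂ + 2 * β₂ * s + γ₂ * s ^ 2 := by
      rw [hq₂, hβ₂, hγ₂]; ring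
    have e4 : (x 0 + s * v 0) ^ 2 + (x 1 + s * v 1) ^ 2 + (x 2 + s * v 2) ^ 2 + (x 3 + s * v 3) ^ 2
        = (q₁ + 2 * β₁ * s + γ₁ * s ^ 2) + (q₂ + 2 * β₂ * s + γ₂ * s ^ 2) := by
      rw [hq₁, hβ₁, hγ₁, hq₂, hβ₂, hγ₂]; ring
    simp only [PiLp.add_apply, PiLp.smul_apply, smul_eq_mul]
    rw [e4, e1, e2]
  -- near `0` the argument of `log` does not vanish
  have hnear : ∀ᶠ t : ℝ in 𝓝 0, q₁ + 2 * β₁ * t + γ₁ * t ^ 2 + 1 / 1000 ≠ 0 := by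
    have hc : Continuous fun t : ℝ => q₁ + 2 * β₁ * t + γ₁ * t ^ 2 + 1 / 1000 := by fun_prop
    exact hc.continuousAt.eventually_ne (by simpa using hq)
  have hf : ContDiffAt ℝ 2 (fun y : EuclideanSpace ℝ (Fin 4) => -8 * Real.smoothTransition ((81 / 100 - (y 2 ^ 2 + y 3 ^ 2)) * (25 / 14)) * Real.log (y 0 ^ 2 + y 1 ^ 2 + 1 / 1000) + M * (y 2 ^ 2 + y 3 ^ 2) + (y 0 ^ 2 + y 1 ^ 2 + y 2 ^ 2 + y 3 ^ 2)) x :=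
    ((helper_frozen_psiContDiff M).of_le (WithTop.coe_le_coe.mpr le_top)).contDiffAt
  refine iteratedFDeriv_two_of_line hf (hnear.mono fun t ht => ?_)
    (slice_deriv_hasDerivAt M q₁ β₁ γ₁ q₂ β₂ γ₂ hq)
  exact (slice_hasDerivAt M q₁ β₁ γ₁ q₂ β₂ γ₂ t ht).congr_of_eventuallyEq
    (Eventually.of_forall hfun)

end Summit.SmoothPoincare4.SmoothPoincare4.Theorems.HyperbolicEnd.Negative

end
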